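import Summits.QuantumFields.YangMills.Theorems.IR.BlockedActivityWMeshCofinal
import HarnessLib

/-!
# Crux `IR` (stmt-QuantumFields-19354), lane B «strong coupling AFTER BLOCKING»: the activity ball is SELF-IMPROVING under blocking at every `β` —
# class W at ONE mesh with radius below the KP entry radius ⇒ class W at EVERY radius at all large multiples of that mesh

Helper module for item `stmt-QuantumFields-19354` (`--supports`; it closes nothing), lane `ym-19354-onsetsc-p2` (g6).  The lane's strategy sentence in its own
currency, as a theorem valid at every `β` and for every compact `G`: once the blocked kernels at SOME mesh `b` lie in the activity ball of KP entry radius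
(`a ≤ radiusKP ε`, `ε ≤ 1`, `ε·shellCount n < 1` — e.g. THE NUMBER `a⋆ = radiusKP(1∕3552)` at window `1`), further blocking CONTRACTS the ball: for every target
radius `a' > 0` the class of record holds at all meshes `K·b`, `K ≥ K₀(β, b, a')`.  Composition of g0's sandwich edge W ⇒ TV
(`univShellCond_of_blockedActivityW_sharp`, KP cluster expansion) with g6's TV ⇒ W (`blockedActivityClassW_of_univShellCond` ∕ `…_cofinal_of_univShellCond`, DS
bootstrap + DLR peeling + refinement).

* ★ `blockedActivityClassW_selfImproving` — `BlockedActivityClassW r.ρ β b n a`, `a ≤ radiusKP ε`, `0 ≤ ε ≤ 1`, `ε·shellCount n < 1`, `b ≥ 1` ⇒ `∀ a' > 0, ∃ K₀, ∀ K ≥ K₀,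
  BlockedActivityClassW r.ρ β (K·b) 1 a'`; explicit law `blockedActivityClassW_mul_of_blockedActivityClassW` (radius `mixingRadius r.N β (ε·shellCount n) (K·b) j` at
  `K ≥ j(2n+1)+2`).
* ★ `blockedActivityClassW_contracting_aStar` — entry at THE NUMBER: `BlockedActivityClassW r.ρ β b 1 (radiusKP (1∕3552))` ⇒ every radius at all large multiples of `b`;
  `blockedActivityOnsetAtW_iff_aStar` — the W-onset is equivalent to its single-radius instance at `a⋆` (`∃ β₂, ∀ β ≥ β₂, ∃ b ≥ 1, BlockedActivityClassW r.ρ β b 1 a⋆`).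

CAVEAT (numbers, not adjectives): `K₀` depends on `β` (factor `e^{24N|β|}` in `mixingRadius`) and on `b` (factor `b⁴`); the contraction is NOT uniform in `β` — consistent
with the log-in-ξ loss recorded in `Theorems/IR/BlockedActivityWOfMixing`.  HONEST FRAMING: a conditional self-improvement valid at every `β`; entry into the ball at a
`β`-dependent mesh `b(β) ≍ ξ(β)` is the OPEN content of the lane (weak-coupling complete analyticity); nothing here asserts it, nor a gap, nor Clay.  No `sorry`;
axioms ⊆ {propext, Classical.choice, Quot.sound}; no instances, no notation.
-/

set_option autoImplicit false

noncomputable section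

open MeasureTheory ProbabilityTheory Filter Topology
open Literature.MathematicalPhysics
open Literature.MathematicalPhysics.QuantumLattice
open Summit.QuantumFields.YangMills.Cruxes.IR.OnsetFormats (shellCount UnivShellCond)

namespace Summit.QuantumFields.YangMills.Cruxes.IR.BlockedActivity

section SelfImproving

variable (G : Type) [Group G] [TopologicalSpace G] [IsTopologicalGroup G] [CompactSpace G] [MeasurableSpace G] [BorelSpace G]
  (r : Literature.MathematicalPhysics.QuantumFieldTheory.LatticeRep G)

/-- **Explicit contraction law.**  Class W at `(b, n, a)` with `a ≤ radiusKP ε`, `0 ≤ ε ≤ 1` ⇒ class W at `(K·b, 1)` with radius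
`mixingRadius r.N β (ε·shellCount n) (K·b) j` for every `j` and `K ≥ j(2n+1)+2` (W ⇒ TV by the KP sandwich, TV ⇒ W by bootstrap + peeling + refinement). -/
theorem blockedActivityClassW_mul_of_blockedActivityClassW {β a ε : ℝ} {b n : ℕ} (hb : 1 ≤ b) (hC : BlockedActivityClassW r.ρ β b n a)
    (hε0 : 0 ≤ ε) (hε1 : ε ≤ 1) (haε : a ≤ radiusKP ε) (j : ℕ) {K : ℕ} (hK : j * (2 * n + 1) + 2 ≤ K) :
    BlockedActivityClassW r.ρ β (K * b) 1 (mixingRadius r.N β (ε * shellCount n) (K * b) j) :=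
  blockedActivityClassW_of_univShellCond G r hb hε0 (univShellCond_of_blockedActivityW_sharp hC hε1 haε) j hK

/-- ★ **THE ACTIVITY BALL IS SELF-IMPROVING UNDER BLOCKING (every `β`, every compact `G`).**  `BlockedActivityClassW r.ρ β b n a` with `a ≤ radiusKP ε`, `0 ≤ ε ≤ 1`,
`ε·shellCount n < 1`, `b ≥ 1` ⇒ for every `a' > 0` there is `K₀` with `BlockedActivityClassW r.ρ β (K·b) 1 a'` for all `K ≥ K₀`. -/
theorem blockedActivityClassW_selfImproving {β a ε : ℝ} {b n : ℕ} (hb : 1 ≤ b) (hC : BlockedActivityClassW r.ρ β b n a)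
    (hε0 : 0 ≤ ε) (hε1 : ε ≤ 1) (hlt : ε * shellCount n < 1) (haε : a ≤ radiusKP ε) {a' : ℝ} (ha' : 0 < a') :
    ∃ K₀ : ℕ, ∀ K : ℕ, K₀ ≤ K → BlockedActivityClassW r.ρ β (K * b) 1 a' :=
  blockedActivityClassW_cofinal_of_univShellCond G r hb hε0 hlt (univShellCond_of_blockedActivityW_sharp hC hε1 haε) ha'

/-- ★ **Entry at THE NUMBER `a⋆ = radiusKP(1∕3552)`, window `1`**: class W at `(b, 1, a⋆)` ⇒ class W at every radius at all large multiples of `b`. -/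
theorem blockedActivityClassW_contracting_aStar {β : ℝ} {b : ℕ} (hb : 1 ≤ b) (hC : BlockedActivityClassW r.ρ β b 1 (radiusKP (1 / 3552)))
    {a' : ℝ} (ha' : 0 < a') : ∃ K₀ : ℕ, ∀ K : ℕ, K₀ ≤ K → BlockedActivityClassW r.ρ β (K * b) 1 a' :=
  blockedActivityClassW_selfImproving G r hb hC (by norm_num) (by norm_num) (by rw [shellCount_one]; norm_num) le_rfl ha'

/-- **The W-onset is its single-radius instance at `a⋆`**: `BlockedActivityOnsetAtW r.ρ ↔ ∃ β₂, ∀ β ≥ β₂, ∃ b ≥ 1, BlockedActivityClassW r.ρ β b 1 (radiusKP (1∕3552))`. -/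
theorem blockedActivityOnsetAtW_iff_aStar :
    BlockedActivityOnsetAtW r.ρ ↔ ∃ β₂ : ℝ, ∀ β : ℝ, β₂ ≤ β → ∃ b : ℕ, 1 ≤ b ∧ BlockedActivityClassW r.ρ β b 1 (radiusKP (1 / 3552)) := by
  constructor
  · intro h
    exact h _ (radiusKP_pos (by norm_num))
  · rintro ⟨β₂, hβ⟩ a' ha'
    refine ⟨β₂, fun β hle => ?_⟩
    obtain ⟨b, hb1, hC⟩ := hβ β hle
    obtain ⟨K₀, hK₀⟩ := blockedActivityClassW_contracting_aStar G r hb1 hC ha'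
    exact ⟨(K₀ + 1) * b, hb1.trans (Nat.le_mul_of_pos_left b (Nat.succ_pos K₀)), hK₀ (K₀ + 1) (Nat.le_succ K₀)⟩

end SelfImproving

end Summit.QuantumFields.YangMills.Cruxes.IR.BlockedActivity

end
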